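import Summits.QuantumFields.YangMills.Theorems.BalabanUVNodesN07CritMultiScaleLamBond
import Literature.MathematicalPhysics.QuantumFieldTheory.Balaban1983to89.Node00.CriticalOnFibreTop

/-!
# NODE N07 ([15] = [Balaban1985Variational]) — MODULE 37b: TANGENT-CRITICAL ⇒ CURVE-CRITICAL ON EVERY MULTI-SCALE FIBRE;
# THE EQUIVALENCE «CURVE FORM ⇔ (82)» ON PRINT'S (2.3) FIBRE AND ON EVERY CHAIN-FREE DETERMINING SET; THE UNCONDITIONAL HALF FOR THE (b) FIBRE OF `genSet`

Cell `pub-ymgap`, seat `pub-ymgap-dag-n07-e` generation 16 (R141 (C), DAG node N07; INBOX INTENT-37).  `--kind proof --supports stmt-QuantumFields-20541 --as helper`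
(K0⁷; count-neutral).

THE POINT.  Module 35e (`…N07CritTangentConverse`) proved «TANGENT-critical ⇒ CURVE-critical» at the ONE-SCALE pin: the velocity of a fibre curve through `U` is
`U·X` with `X ∈ 𝔰𝔲(N)` (closed-subgroup velocity lemma), and `X` is a kernel direction because `Ū^k` is constant along the curve and the Fréchet derivative of the
`C^∞` matrix extension `iterM k` (35b-i) computes the velocity of `Ū^k` along ANY bond-wise differentiable family with the same base point and velocities.  That
argument is BOND-BY-BOND and LEVEL-BY-LEVEL, so it holds for EVERY level-indexed family `Λ` of pinned bonds — no chain-freeness, no chart, no lift (§1, ★★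
`curveCritical_of_tangentCritical_family`).  Consequences at NODE 00's objects (§2): ★★ `isCritOnFibre_of_tangentCritical` — for EVERY determining set `𝐁`
(in particular stub 1's `genSet s.Ω k`, reading (b)) tangent-criticality on the joint kernel implies the tree's curve-form pin `IsCritOnFibre F N K 𝐁 W U`
UNCONDITIONALLY (the ⇒ direction needs ROAD B there, HOME `LOCATED-MULTISCALE-FIBRE.md` § B); ★★ `critLam_of_tangentCritical` and, with 37a, ★★★
`critLam_iff_tangentCritical` — on PRINT'S (2.3) multi-scale fibre the curve form of «critical configuration of (5)» IS print's (82) on (83) at small fields;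
★★ `isCritOnFibre_iff_tangentCritical_of_chainFree` — the same equivalence for every chain-free determining set (35j's hypothesis `hCF`), the one-scale pin
`atScale k` being 35e's case (`chainFree_atScale`); ★ `critLam_of_minimal_classTop` — «minimal over print's class (6) on a top domain ⇒ curve-critical» on the (2.3)
fibre (Fermat + curve-openness, the `LamBond` twin of `Node00.isCritOnFibre_of_isMinimizer_classTop`), so that on print's fibre MINIMAL ⇒ CURVE-CRITICAL ⇔ (82) ⇒ (141).

HONEST FRAMING: count-neutral calculus about the tree's own objects (35b-i's `iterM`, 35e §1–§2, 35j, 37a); smallness side conditions are the route `UnitScaleTilt`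
corrector's (`stokesConst·t₀ < δ_N` for ⇐; `< |I|⁻¹∕16` in addition for ⇒); nothing of [15]'s estimates; which reading K0⁷ stub 1 carries is plan ∕ r12's; stub 1 ∕
K0⁷ NOT closed; N07 NOT discharged (5∕27); one finite T⁴ programme at fixed ε — NOT continuum ∕ ℝ⁴ ∕ OS ∕ mass gap ∕ Clay.  No `sorry`, no `def`, no `instance`,
no `notation`.
References: T. Bałaban, CMP **102** (1985) 277–309 [Balaban1985Variational] ((3)–(7) p.278, (82)–(83) p.290, (141) p.299, Prop. 8 p.304); CMP **96** (1984)
223–250 [Balaban1984PropagatorsII] ((2.1)–(2.3) p.224); CMP **119** (1988) 243–285 [Balaban1988Convergent] ((2.2), (2.10)–(2.12) pp.255–256); CMP **109**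
(1987) 249–301 [Balaban1987RG1] ((0.4) p.253, (0.21) p.256); B. C. Hall, *Lie Groups, Lie Algebras, and Representations* (2015) [Hall2015] (Prop. 3.24).
-/

noncomputable section

open scoped Matrix.Norms.L2Operator Topology BigOperators
open Filter Asymptotics Function NormedSpace

namespace Summit.QuantumFields.YangMills.BalabanUVNodes.N07CritMultiScaleConverse

open Literature.MathematicalPhysics.QuantumFieldTheory.Balaban1983to89
open Literature.MathematicalPhysics.QuantumFieldTheory.Balaban1983to89.T4Continuum (T4Family)
open Literature.MathematicalPhysics.QuantumFieldTheory.Balaban1983to89.B15DeterminingSets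
open Literature.MathematicalPhysics.QuantumFieldTheory.Balaban1983to89.B6SectADomainsV1 (Domains)
open Literature.MathematicalPhysics.QuantumFieldTheory.Balaban1983to89.BlockAveraging
open Literature.MathematicalPhysics.QuantumFieldTheory.Balaban1983to89.BlockAveragingHaarAC (centralBond)
open Literature.MathematicalPhysics.QuantumFieldTheory.Balaban1983to89.BlockAveragingEMLHaarAC (emlWeight)
open Literature.MathematicalPhysics.QuantumFieldTheory.Balaban1983to89.ExpMeanLog (expMeanLogSU deltaSU)
open Literature.MathematicalPhysics.QuantumFieldTheory.Balaban1983to89.T4AdjointCovarianceUnitary (lieSU)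
open Literature.MathematicalPhysics.QuantumFieldTheory.Balaban1983to89.Node00
open Summit.QuantumFields.YangMills.Theorems.BlockAvgCorrector (stokesConst)
open Summit.QuantumFields.YangMills.BalabanUVNodes.N07CritTangentConverse (star_mul_deriv_mem_lieSU coe_mul_star_mul_eq hasDerivAt_coeField_iter)
open Summit.QuantumFields.YangMills.BalabanUVNodes.N07CritMultiScaleChainFree (hasDerivAt_wilsonAction4_expChart_of_isCritOnFibre_chainFree)
open Summit.QuantumFields.YangMills.BalabanUVNodes.N07CritMultiScaleLamBond (hasDerivAt_wilsonAction4_expChart_of_critLam)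

/-! ## §1  Tangent-critical ⇒ curve-critical for EVERY level-indexed family of pinned bonds (every torus, every `N`) -/

section Converse

variable {P : Params} {N : ℕ} [NeZero N]

/-- ★★ **TANGENT-CRITICAL ⇒ CURVE-CRITICAL ON EVERY MULTI-SCALE FIBRE.**  On a torus `P`, let `Λ j` (`j ≤ k₀`) be ANY family of pinned bonds with datum `W`, let `U`
have `t₀`-small iterated averages `Ū^i`, `i < k₀` (`stokesConst·t₀ < δ_N`), and suppose `d∕dt A(U·exp(tX))∣₀ = 0` for every JOINT-KERNEL direction `X` (the velocity of
`Ū^j(U·exp tX)(c)` at `0` vanishes at every pinned `c ∈ Λ j`, `j ≤ k₀`).  Then along every curve `γ` through `U`, differentiable at `0` as bond matrices and lying in the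
fibre «`Ū^j(γ t) = W_j` on `Λ j`, `j ≤ k₀`» for `t` near `0`, the derivative of `A` vanishes.  Proof (35e's, bond by bond): the velocity of `γ` is `U·X`, `X ∈ 𝔰𝔲(N)`;
at each pinned `c` the velocity of `Ū^j(γ t)(c)` is the `c`-component of `D(iterM j)_U[U·X]` (35e `hasDerivAt_coeField_iter`) and is `0` (constant along `γ`), and
the ray has the same velocity, so `X` is a joint-kernel direction; tangent-criticality along the ray transfers to `γ` (same base point, same velocities).  NO
chain-freeness, NO chart, NO lift. [cite: Balaban1985Variational, (3),(5)–(7) p.278, (82)–(83) p.290, (141) p.299, p.300; Balaban1987RG1, (0.4) p.253, (0.21) p.256] -/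
theorem curveCritical_of_tangentCritical_family {t₀ : ℝ} (ht₀ : 0 < t₀) (hstδ : stokesConst P * t₀ < deltaSU (Fin N)) {k₀ : ℕ}
    (Λ : (j : ℕ) → Set (PBond P j)) (W : (j : ℕ) → GaugeField P j (SU N)) {U : GaugeField P 0 (SU N)}
    (hsm : ∀ i, i < k₀ → PlaqSmall t₀ (Averaging.iter (fun i => blockAvg (P := P) (j := i) (expMeanLogSU (n := Fin N))) i U))
    (htan : ∀ X : PBond P 0 → lieSU (Fin N),
      (∀ j, j ≤ k₀ → ∀ c ∈ Λ j, HasDerivAt (fun t : ℝ => ((Averaging.iter (fun i => blockAvg (P := P) (j := i) (expMeanLogSU (n := Fin N))) j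
        (expChart U (t • X)) c : SU N) : Matrix (Fin N) (Fin N) ℂ)) 0 0) →
      HasDerivAt (fun t : ℝ => wilsonAction4 (expChart U (t • X))) 0 0)
    (γ : ℝ → GaugeField P 0 (SU N)) (hγ0 : γ 0 = U)
    (hd : DifferentiableAt ℝ (fun (t : ℝ) (b : PBond P 0) => ((γ t b : SU N) : Matrix (Fin N) (Fin N) ℂ)) 0)
    (hfib : ∀ᶠ t in 𝓝 (0 : ℝ), ∀ j, j ≤ k₀ → ∀ c ∈ Λ j,
      Averaging.iter (fun i => blockAvg (P := P) (j := i) (expMeanLogSU (n := Fin N))) j (γ t) c = W j c)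
    {a : ℝ} (ha : HasDerivAt (fun t => wilsonAction4 (γ t)) a 0) : a = 0 := by
  subst hγ0
  -- bond-wise velocities `Y` of `γ` and the Lie-algebra field `X = U⋆·Y`
  have hdY : HasDerivAt (fun t => coeField (γ t)) (deriv (fun t => coeField (γ t)) 0) 0 := hd.hasDerivAt
  set Y : PBond P 0 → Matrix (Fin N) (Fin N) ℂ := deriv (fun t => coeField (γ t)) 0 with hYdef
  have hY : ∀ b, HasDerivAt (fun t => ((γ t b : SU N) : Matrix (Fin N) (Fin N) ℂ)) (Y b) 0 := fun b => (hasDerivAt_pi.1 hdY) b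
  set X : PBond P 0 → lieSU (Fin N) := fun b =>
    ⟨star ((γ 0 b : SU N) : Matrix (Fin N) (Fin N) ℂ) * Y b, star_mul_deriv_mem_lieSU (γ := fun t => γ t b) (hY b)⟩ with hXdef
  have hUX : ∀ b, ((γ 0 b : SU N) : Matrix (Fin N) (Fin N) ℂ) * ((X b : lieSU (Fin N)) : Matrix (Fin N) (Fin N) ℂ) = Y b :=
    fun b => coe_mul_star_mul_eq (γ 0 b) (Y b)
  -- the ray has bond-wise velocity `U·X = Y`
  have hray : ∀ b, HasDerivAt (fun t : ℝ => ((expChart (γ 0) (t • X) b : SU N) : Matrix (Fin N) (Fin N) ℂ)) (Y b) 0 := fun b => by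
    rw [← hUX b]
    exact hasDerivAt_coe_expChart_along (U := γ 0) (c := fun t : ℝ => t • X) (hasDerivAt_ray X) (zero_smul ℝ X) b
  have hrayPi : HasDerivAt (fun t : ℝ => coeField (expChart (γ 0) (t • X))) Y 0 := hasDerivAt_pi.2 hray
  have hray0 : (fun t : ℝ => expChart (γ 0) (t • X)) 0 = γ 0 := by
    show expChart (γ 0) ((0 : ℝ) • X) = γ 0
    rw [zero_smul, expChart_zero]
  -- `X` is a JOINT-kernel direction: at every pinned `c ∈ Λ j`, `j ≤ k₀`, the velocity of `Ū^j` along `γ` is `(D Y) c = 0`, and along the ray it is `(D Y) c` too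
  have hX : ∀ j, j ≤ k₀ → ∀ c ∈ Λ j, HasDerivAt (fun t : ℝ => ((Averaging.iter (fun i => blockAvg (P := P) (j := i) (expMeanLogSU (n := Fin N))) j
      (expChart (γ 0) (t • X)) c : SU N) : Matrix (Fin N) (Fin N) ℂ)) 0 0 := by
    intro j hj c hc
    have hsmj : ∀ i, i < j → PlaqSmall t₀ (Averaging.iter (fun i => blockAvg (P := P) (j := i) (expMeanLogSU (n := Fin N))) i (γ 0)) :=
      fun i hi => hsm i (lt_of_lt_of_le hi hj)
    set D := fderiv ℝ (iterM j : (PBond P 0 → Matrix (Fin N) (Fin N) ℂ) → PBond P j → Matrix (Fin N) (Fin N) ℂ) (coeField (γ 0)) with hDdef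
    have hγD : HasDerivAt (fun t => coeField (Averaging.iter (fun i => blockAvg (P := P) (j := i) (expMeanLogSU (n := Fin N))) j (γ t))) (D Y) 0 :=
      hasDerivAt_coeField_iter ht₀ hstδ hdY hsmj
    have hγDc : HasDerivAt (fun t => ((Averaging.iter (fun i => blockAvg (P := P) (j := i) (expMeanLogSU (n := Fin N))) j (γ t) c : SU N) :
        Matrix (Fin N) (Fin N) ℂ)) (D Y c) 0 := (hasDerivAt_pi.1 hγD) c
    have hγ0c : HasDerivAt (fun t => ((Averaging.iter (fun i => blockAvg (P := P) (j := i) (expMeanLogSU (n := Fin N))) j (γ t) c : SU N) :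
        Matrix (Fin N) (Fin N) ℂ)) 0 0 := by
      refine (hasDerivAt_const (0 : ℝ) ((W j c : SU N) : Matrix (Fin N) (Fin N) ℂ)).congr_of_eventuallyEq ?_
      exact hfib.mono fun t ht => by
        show ((Averaging.iter _ j (γ t) c : SU N) : Matrix (Fin N) (Fin N) ℂ) = ((W j c : SU N) : Matrix (Fin N) (Fin N) ℂ)
        rw [ht j hj c hc]
    have hDYc : D Y c = 0 := hγDc.unique hγ0c
    have hrayD : HasDerivAt (fun t : ℝ => coeField (Averaging.iter (fun i => blockAvg (P := P) (j := i) (expMeanLogSU (n := Fin N))) j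
        (expChart (γ 0) (t • X)))) (D Y) 0 := by
      have h := hasDerivAt_coeField_iter (Γ := fun t : ℝ => expChart (γ 0) (t • X)) ht₀ hstδ hrayPi (k := j)
        (by intro i hi; simp only [zero_smul, expChart_zero]; exact hsmj i hi)
      simp only [zero_smul, expChart_zero] at h
      exact h
    have h := (hasDerivAt_pi.1 hrayD) c
    rw [hDYc] at h
    exact h
  -- tangent-criticality along the ray, transferred to `γ` (same base point, same velocities)
  have hA := htan X hX
  have hγA : HasDerivAt (fun t => wilsonAction4 (γ t)) 0 0 :=
    hasDerivAt_wilsonAction4_of_sameVelocity (γ₁ := fun t : ℝ => expChart (γ 0) (t • X)) (γ₂ := γ) hray0 hray hY hA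
  exact ha.unique hγA

end Converse

/-! ## §2  At NODE 00's objects: the unconditional half for every determining set; the equivalences on print's fibre and on chain-free sets -/

section Record

variable {F : T4Family} {N : ℕ} [NeZero N]

/-- ★★ **TANGENT-CRITICAL ⇒ `IsCritOnFibre`, FOR EVERY DETERMINING SET** — in particular for stub 1's `genSet s.Ω k` (reading (b), bonds MEETING `Γ_j`): if `U` has
`t₀`-small iterated averages below `k₀` and `d∕dt A(U·exp tX)|₀ = 0` for every direction `X` in the joint kernel of the linearised constraint `(Ū^j∣bondsOf (𝐁 j))_{j ≤ k₀}`
(the levels `≤ k₀` only — for `𝐁` with no member above `k₀` this is the full joint kernel), then `U` is a critical configuration of (5) on the fibre `𝔅(𝐁, W)` through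
`U` in the CURVE form.  UNCONDITIONAL: no chain-freeness (the ⇒ direction on the (b) fibre is the open ROAD B).  The datum `W` enters only through the fibre `U` lies on.
[cite: Balaban1985Variational, (3),(5)–(7) p.278, (82)–(83) p.290, Prop. 8 p.304; Balaban1988Convergent, (2.2), (2.10)–(2.12) pp.255–256; Balaban1987RG1, (0.4), (0.21) pp.253–256] -/
theorem isCritOnFibre_of_tangentCritical {K k₀ : ℕ} {𝔹 : DetSet (F.P K)} {t₀ : ℝ} (ht₀ : 0 < t₀)
    (hstδ : stokesConst (F.P K) * t₀ < deltaSU (Fin N)) {W : MSField (F.P K) (SU N)} {U : GaugeField (F.P K) 0 (SU N)}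
    (hsm : ∀ i, i < k₀ → PlaqSmall t₀ (avgFamily (avOfRecord F N K) U i))
    (htan : ∀ X : PBond (F.P K) 0 → lieSU (Fin N),
      (∀ j, j ≤ k₀ → ∀ c ∈ bondsOf (𝔹 j), HasDerivAt
        (fun t : ℝ => ((avgFamily (avOfRecord F N K) (expChart U (t • X)) j c : SU N) : Matrix (Fin N) (Fin N) ℂ)) 0 0) →
      HasDerivAt (fun t : ℝ => wilsonAction4 (expChart U (t • X))) 0 0) :
    IsCritOnFibre F N K 𝔹 W U := by
  intro γ hγ0 hd hfib a ha
  refine curveCritical_of_tangentCritical_family (P := F.P K) ht₀ hstδ (k₀ := k₀) (fun j => bondsOf (𝔹 j)) W (U := U) hsm htan γ hγ0 hd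
    (hfib.mono fun t ht j _ c hc => ht j c hc) ha

/-- ★ **«MINIMAL ⇒ CRITICAL» OVER PRINT'S CLASS (6) ON A TOP DOMAIN, ON PRINT'S (2.3) FIBRE** (the `LamBond` twin of `Node00.isCritOnFibre_of_isMinimizer_classTop`;
class literal of FILE 12b ∕ stub 1: (1.7) on `Sect2.omegaPlaqsTop Ω Ω₀ n` at ANY thresholds `r_n`, (1.9) `Sect2.CoDivClassOnTop Ω Ω₀ k ε`; the minimiser hypothesis SPELLED OUT:
`U₀` in the class and of least action among class members on the (2.3) fibre of `W`): `U₀` is a critical configuration of (5) on the (2.3) fibre in the curve form — a curve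
through `U₀` differentiable at `0` stays in the OPEN class (`eventually_mem_classTop`), and Fermat applies.  With 37a: minimal ⇒ curve-critical ⇒ (82) ⇒ (141) on print's fibre.
[cite: Balaban1985Variational, (5)–(7) p.278, p.299 («minimal configuration»), Prop. 8 p.304; Balaban1985RegularSpaces, (1.7)–(1.9) p.77; Balaban1988Convergent, (2.12) p.256; Balaban1984PropagatorsII, (2.3) p.224] -/
theorem critLam_of_minimal_classTop {K k : ℕ} (D : Domains (F.P K)) {Ω : ℕ → Set (Site (F.P K) 0)} {Ω₀ : Set (Site (F.P K) 0)} {r : ℕ → ℝ} {ε : ℝ}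
    {W : MSField (F.P K) (SU N)} {U₀ : GaugeField (F.P K) 0 (SU N)}
    (hmem : (∀ n, n ≤ k → PlaqSmallOn (Sect2.omegaPlaqsTop Ω Ω₀ n) (r n) U₀) ∧ Sect2.CoDivClassOnTop Ω Ω₀ k ε U₀)
    (hmin : ∀ U : GaugeField (F.P K) 0 (SU N),
      ((∀ n, n ≤ k → PlaqSmallOn (Sect2.omegaPlaqsTop Ω Ω₀ n) (r n) U) ∧ Sect2.CoDivClassOnTop Ω Ω₀ k ε U) →
        (∀ j (c : PBond (F.P K) j), D.LamBond j c → avgFamily (avOfRecord F N K) U j c = W j c) → wilsonAction4 U₀ ≤ wilsonAction4 U) :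
    ∀ γ : ℝ → GaugeField (F.P K) 0 (SU N), γ 0 = U₀ →
      DifferentiableAt ℝ (fun (t : ℝ) (b : PBond (F.P K) 0) => ((γ t b : SU N) : Matrix (Fin N) (Fin N) ℂ)) 0 →
        (∀ᶠ t in 𝓝 (0 : ℝ), ∀ j (c : PBond (F.P K) j), D.LamBond j c → avgFamily (avOfRecord F N K) (γ t) j c = W j c) →
          ∀ a : ℝ, HasDerivAt (fun t => wilsonAction4 (γ t)) a 0 → a = 0 := by
  intro γ h0 hd hc a ha
  have hγ : ContinuousAt (fun t (b : PBond (F.P K) 0) => γ t b) 0 := continuousAt_of_differentiableAt_val hd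
  have hU : (∀ n, n ≤ k → PlaqSmallOn (Sect2.omegaPlaqsTop Ω Ω₀ n) (r n) (γ 0)) ∧ Sect2.CoDivClassOnTop Ω Ω₀ k ε (γ 0) := by
    rw [h0]
    exact hmem
  refine IsLocalMin.hasDerivAt_eq_zero ?_ ha
  show ∀ᶠ t in 𝓝 (0 : ℝ), wilsonAction4 (γ 0) ≤ wilsonAction4 (γ t)
  filter_upwards [eventually_mem_classTop hγ hU, hc] with t ht hct
  rw [h0]
  exact hmin (γ t) ht hct

/-- ★★ **TANGENT-CRITICAL ⇒ CURVE-CRITICAL ON PRINT'S (2.3) FIBRE** (`D : Domains (F.P K)`; the criticality conclusion spelled out as in 37a).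
[cite: Balaban1985Variational, (3),(5)–(7) p.278, (82)–(83) p.290; Balaban1984PropagatorsII, (2.3) p.224; Balaban1987RG1, (0.4), (0.21) pp.253–256] -/
theorem critLam_of_tangentCritical {K : ℕ} (D : Domains (F.P K)) {t₀ : ℝ} (ht₀ : 0 < t₀) (hstδ : stokesConst (F.P K) * t₀ < deltaSU (Fin N))
    {W : MSField (F.P K) (SU N)} {U : GaugeField (F.P K) 0 (SU N)} (hsm : ∀ i, i < D.k → PlaqSmall t₀ (avgFamily (avOfRecord F N K) U i))
    (htan : ∀ X : PBond (F.P K) 0 → lieSU (Fin N),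
      (∀ j (c : PBond (F.P K) j), D.LamBond j c → HasDerivAt
        (fun t : ℝ => ((avgFamily (avOfRecord F N K) (expChart U (t • X)) j c : SU N) : Matrix (Fin N) (Fin N) ℂ)) 0 0) →
      HasDerivAt (fun t : ℝ => wilsonAction4 (expChart U (t • X))) 0 0) :
    ∀ γ : ℝ → GaugeField (F.P K) 0 (SU N), γ 0 = U →
      DifferentiableAt ℝ (fun (t : ℝ) (b : PBond (F.P K) 0) => ((γ t b : SU N) : Matrix (Fin N) (Fin N) ℂ)) 0 →
        (∀ᶠ t in 𝓝 (0 : ℝ), ∀ j (c : PBond (F.P K) j), D.LamBond j c → avgFamily (avOfRecord F N K) (γ t) j c = W j c) →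
          ∀ a : ℝ, HasDerivAt (fun t => wilsonAction4 (γ t)) a 0 → a = 0 := by
  intro γ hγ0 hd hfib a ha
  refine curveCritical_of_tangentCritical_family (P := F.P K) ht₀ hstδ (k₀ := D.k) (fun j => {b | D.LamBond j b}) W (U := U) hsm
    (fun X hX => htan X fun j c hc => hX j (D.le_of_lamBond hc) c hc) γ hγ0 hd (hfib.mono fun t ht j _ c hc => ht j c hc) ha

/-- ★★★ **ON PRINT'S (2.3) MULTI-SCALE FIBRE THE TWO READINGS COINCIDE AT SMALL FIELDS.**  At NODE 00's objects, for a domain family `D`, a datum `W` and a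
configuration `U` ON the fibre «`Ū^j(U) = W_j` on `Λ_j`» with `t₀`-small iterated averages below `k` (`stokesConst·t₀ < |I|⁻¹∕16`, `< δ_N`): `U` is a critical
configuration of (5) on the fibre in the CURVE form IF AND ONLY IF `d∕dt A(U·exp(tX))∣₀ = 0` for every joint-kernel direction `X` — print's (82) on (83).  (⇒ is
37a `hasDerivAt_wilsonAction4_expChart_of_critLam`: chain-freeness of (2.3) + 35j's ascending corrector; ⇐ is §1.)
[cite: Balaban1985Variational, p.277, (3),(5)–(7) p.278, (82)–(83) p.290, (141) p.299, p.300, Prop. 8 p.304; Balaban1984PropagatorsII, (2.1)–(2.3) p.224; Balaban1987RG1, (0.4) p.253] -/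
theorem critLam_iff_tangentCritical {K : ℕ} (D : Domains (F.P K)) {t₀ : ℝ} (ht₀ : 0 < t₀)
    (hst : stokesConst (F.P K) * t₀ < emlWeight (F.P K) / 16) (hstδ : stokesConst (F.P K) * t₀ < deltaSU (Fin N))
    {W : MSField (F.P K) (SU N)} {U : GaugeField (F.P K) 0 (SU N)}
    (hsm : ∀ i, i < D.k → PlaqSmall t₀ (avgFamily (avOfRecord F N K) U i))
    (hfib : ∀ j (c : PBond (F.P K) j), D.LamBond j c → avgFamily (avOfRecord F N K) U j c = W j c) :
    (∀ γ : ℝ → GaugeField (F.P K) 0 (SU N), γ 0 = U →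
      DifferentiableAt ℝ (fun (t : ℝ) (b : PBond (F.P K) 0) => ((γ t b : SU N) : Matrix (Fin N) (Fin N) ℂ)) 0 →
        (∀ᶠ t in 𝓝 (0 : ℝ), ∀ j (c : PBond (F.P K) j), D.LamBond j c → avgFamily (avOfRecord F N K) (γ t) j c = W j c) →
          ∀ a : ℝ, HasDerivAt (fun t => wilsonAction4 (γ t)) a 0 → a = 0) ↔
    ∀ X : PBond (F.P K) 0 → lieSU (Fin N),
      (∀ j (c : PBond (F.P K) j), D.LamBond j c → HasDerivAt
        (fun t : ℝ => ((avgFamily (avOfRecord F N K) (expChart U (t • X)) j c : SU N) : Matrix (Fin N) (Fin N) ℂ)) 0 0) →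
      HasDerivAt (fun t : ℝ => wilsonAction4 (expChart U (t • X))) 0 0 :=
  ⟨fun hcrit _ hX => hasDerivAt_wilsonAction4_expChart_of_critLam D ht₀ hst hstδ hsm hfib hcrit hX,
    critLam_of_tangentCritical D ht₀ hstδ hsm⟩

/-- ★★ **THE EQUIVALENCE FOR EVERY CHAIN-FREE DETERMINING SET** (35j's hypothesis `hCF`; `𝐁` with no member above `k₀ ≤ m + K`; `U` on the fibre with `t₀`-small
iterated averages below `k₀`): `IsCritOnFibre F N K 𝐁 W U` ⟺ tangent-criticality on the joint kernel.  The one-scale pin `atScale k` is chain-free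
(`N07CritMultiScaleChainFree.chainFree_atScale`) — 35e's `isCritOfRecord_iff_tangentCritical` in `DetSet` currency.
[cite: Balaban1985Variational, (3),(5)–(7) p.278, (82)–(83) p.290, Prop. 8 p.304; Balaban1988Convergent, (2.2), (2.10)–(2.12) pp.255–256; Balaban1987RG1, (0.4) p.253] -/
theorem isCritOnFibre_iff_tangentCritical_of_chainFree {K k₀ : ℕ} (hk₀ : k₀ ≤ (F.P K).m + (F.P K).K) {𝔹 : DetSet (F.P K)}
    (h𝔹 : ∀ j, k₀ < j → 𝔹 j = ∅) {t₀ : ℝ} (ht₀ : 0 < t₀) (hst : stokesConst (F.P K) * t₀ < emlWeight (F.P K) / 16)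
    (hstδ : stokesConst (F.P K) * t₀ < deltaSU (Fin N)) {W : MSField (F.P K) (SU N)} {U : GaugeField (F.P K) 0 (SU N)}
    (hsm : ∀ i, i < k₀ → PlaqSmall t₀ (avgFamily (avOfRecord F N K) U i)) (hfib : AgreeOn 𝔹 (avgFamily (avOfRecord F N K) U) W)
    (hCF : ∀ ℓ, ℓ ≤ k₀ → ∃ T : (i : ℕ) → Set (PBond (F.P K) i), bondsOf (𝔹 ℓ) ⊆ T ℓ ∧
      (∀ i, i < ℓ → ∀ c : PBond (F.P K) (i + 1), c ∈ T (i + 1) → centralBond c ∈ T i) ∧ ∀ j, j < ℓ → Disjoint (T j) (bondsOf (𝔹 j))) :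
    IsCritOnFibre F N K 𝔹 W U ↔
      ∀ X : PBond (F.P K) 0 → lieSU (Fin N),
        (∀ j, j ≤ k₀ → ∀ c ∈ bondsOf (𝔹 j), HasDerivAt
          (fun t : ℝ => ((avgFamily (avOfRecord F N K) (expChart U (t • X)) j c : SU N) : Matrix (Fin N) (Fin N) ℂ)) 0 0) →
        HasDerivAt (fun t : ℝ => wilsonAction4 (expChart U (t • X))) 0 0 :=
  ⟨fun hcrit _ hX => hasDerivAt_wilsonAction4_expChart_of_isCritOnFibre_chainFree hk₀ h𝔹 ht₀ hst hstδ hsm hfib hCF hcrit hX,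
    isCritOnFibre_of_tangentCritical ht₀ hstδ hsm⟩

end Record

end Summit.QuantumFields.YangMills.BalabanUVNodes.N07CritMultiScaleConverse

end
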